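import Summits.RiemannHypothesis.RiemannHypothesis.Theses.OddSector
import Summits.RiemannHypothesis.RiemannHypothesis.Theorems.RuelleBandExactFirstBandStubOddSectorCriterion
import Literature.NumberTheory.LFunctions.WeilGroundEnergyProofs
import Literature.NumberTheory.LFunctions.WeilMellinBounds
import Literature.NumberTheory.LFunctions.ZetaRealAxis
import Literature.NumberTheory.LFunctions.GeneralizedRH

/-!
# Crux `OddNegativityOffLine` (stmt-RiemannHypothesis-17780) — idea `contrapose-landed-odd-criterion`

Sketch for the crux-ideate card (ideator 2, round 1).  The lever is the LANDED odd-sector Weil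
criterion `RuelleBandExactFirstBand.stub_oddSectorCriterion` (positivity on odd REAL-valued tests ⟹
every zero of `ζ` in the open strip is on the critical line or on the real axis), contraposed, joined
with `riemannZeta_ofReal_ne_zero_of_pos_of_lt_one` (no real zeros in `(0,1)`) and
`riemannHypothesis_iff_strip_holds` (Mathlib RH ↔ strip RH), then L²-normalised
(`weilQuadratic_const_mul`, `IsWeilTest.const_mul`) and made window-uniform by support inclusion.

* `exists_odd_real_neg` — FIRST LEMMA of the line: `¬RH ⟹ ∃` odd real-valued test `g` with
  `Re Q(g) < 0`.
* `OddRealNegativityOffLine` / `oddRealNegativityOffLine` — the free strengthening C⁺ (real-valued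
  witness), proved.
* `oddNegativityOffLine` — the crux BY NAME, proved (so the idea's cheapest falsifier — "does the
  contrapositive elaborate and close the route decl by `show`?" — is run here: it does).
-/

noncomputable section

namespace Summit.RiemannHypothesis.RiemannHypothesis.Cruxes.OddNegativityOffLine.ContraposeLandedOddCriterion

open MeasureTheory Set
open Literature.NumberTheory.LFunctions
open Summit.RiemannHypothesis.RiemannHypothesis.Theorems.RuelleBandExactFirstBand

/-- FIRST LEMMA.  If RH fails, some smooth compactly supported ODD REAL-valued `g` has
`Re W(g ⋆ g̃) < 0`: contrapose the landed `stub_oddSectorCriterion`; a strip zero on the real axis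
is excluded by `riemannZeta_ofReal_ne_zero_of_pos_of_lt_one`, and strip-RH is RH by
`riemannHypothesis_iff_strip_holds`. -/
theorem exists_odd_real_neg (hRH : ¬ RiemannHypothesis) :
    ∃ g : ℝ → ℂ, IsWeilTest g ∧ (∀ t : ℝ, g (-t) = -g t) ∧ (∀ t : ℝ, (g t).im = 0) ∧
      (weilQuadratic g).re < 0 := by
  by_contra hne
  push Not at hne
  apply hRH
  have hstrip := stub_oddSectorCriterion (fun g hg hodd hreal => hne g hg hodd hreal)
  refine riemannHypothesis_iff_strip_holds.2 fun s hs h0 h1 => ?_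
  rcases hstrip s hs h0 h1 with h | him
  · exact h
  · exfalso
    have e : ((s.re : ℝ) : ℂ) = s := Complex.ext (by simp) (by simp [him])
    have hs' : riemannZeta ((s.re : ℝ) : ℂ) = 0 := by rw [e]; exact hs
    exact riemannZeta_ofReal_ne_zero_of_pos_of_lt_one s.re h0 h1 hs'

/-- C⁺: the crux with a REAL-valued odd witness (Literature vocabulary). -/
def OddRealNegativityOffLine : Prop :=
  ¬ RiemannHypothesis → ∃ η : ℝ, 0 < η ∧ ∃ A : ℝ, ∀ a : ℝ, A ≤ a → ∃ h : ℝ → ℂ,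
    IsWeilTest h ∧ tsupport h ⊆ Set.Icc (-a) a ∧ (∀ t, h (-t) = -h t) ∧ (∀ t, (h t).im = 0) ∧
    ∫ t, ‖h t‖ ^ 2 = (1 : ℝ) ∧ (weilQuadratic h).re ≤ -η

/-- C⁺ holds: normalise the witness of `exists_odd_real_neg` (it is `≠ 0` since `Q(0) = 0`),
`Q(c g) = c² Q(g)` for real `c = ‖g‖₂⁻¹`; `η := -Re Q(c g)`; `A :=` a support radius, and every
larger window contains the support. -/
theorem oddRealNegativityOffLine : OddRealNegativityOffLine := by
  intro hRH
  obtain ⟨g, hg, hodd, hreal, hneg⟩ := exists_odd_real_neg hRH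
  have hN2nn : 0 ≤ ∫ t : ℝ, ‖g t‖ ^ 2 := integral_nonneg fun _ => by positivity
  have hpos : 0 < ∫ t : ℝ, ‖g t‖ ^ 2 := by
    rcases hN2nn.eq_or_lt with hz | hpos
    · exfalso
      have hg0 : g = 0 := hg.eq_zero_of_integral_norm_sq_eq_zero hz.symm
      subst hg0
      rw [weilQuadratic_zero, Complex.zero_re] at hneg
      exact lt_irrefl _ hneg
    · exact hpos
  set N2 : ℝ := ∫ t : ℝ, ‖g t‖ ^ 2 with hN2
  set c : ℝ := (Real.sqrt N2)⁻¹ with hc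
  have hcpos : 0 < c := inv_pos.2 (Real.sqrt_pos.2 hpos)
  -- the normalised witness
  have hht : IsWeilTest fun t => (c : ℂ) * g t := hg.const_mul c
  have hnorm : ∫ t : ℝ, ‖(c : ℂ) * g t‖ ^ 2 = 1 := by
    simp only [norm_mul, mul_pow, Complex.norm_real, Real.norm_of_nonneg hcpos.le]
    rw [integral_const_mul, hc, inv_pow, Real.sq_sqrt hN2nn, inv_mul_cancel₀ hpos.ne']
  have hQ : (weilQuadratic fun t => (c : ℂ) * g t).re = c * c * (weilQuadratic g).re := by
    rw [weilQuadratic_const_mul, Complex.normSq_ofReal, Complex.re_ofReal_mul]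
  have hQneg : (weilQuadratic fun t => (c : ℂ) * g t).re < 0 := by
    rw [hQ]; exact mul_neg_of_pos_of_neg (mul_pos hcpos hcpos) hneg
  -- a support radius
  obtain ⟨r, hr⟩ := hg.2.isCompact.isBounded.subset_closedBall (0 : ℝ)
  refine ⟨-(weilQuadratic fun t => (c : ℂ) * g t).re, by linarith, r, fun a ha => ?_⟩
  refine ⟨fun t => (c : ℂ) * g t, hht, ?_, fun t => ?_, fun t => ?_, hnorm, by linarith⟩
  · refine tsupport_mul_subset_right.trans (hr.trans ?_)
    rw [Real.closedBall_eq_Icc, zero_sub, zero_add]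
    exact Set.Icc_subset_Icc (neg_le_neg ha) ha
  · show (c : ℂ) * g (-t) = -((c : ℂ) * g t)
    rw [hodd, mul_neg]
  · show ((c : ℂ) * g t).im = 0
    simp [Complex.mul_im, hreal t]

/-- C⁺ ⟹ crux (forget realness; the route decl is reached by `show`, rev-1 defeq). -/
theorem oddNegativityOffLine_of_real (H : OddRealNegativityOffLine) :
    Summit.RiemannHypothesis.RiemannHypothesis.Theses.OddSector.OddNegativityOffLine := by
  show ¬ RiemannHypothesis → ∃ η : ℝ, 0 < η ∧ ∃ A : ℝ, ∀ a : ℝ, A ≤ a → ∃ h : ℝ → ℂ,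
    IsWeilTest h ∧ tsupport h ⊆ Set.Icc (-a) a ∧ (∀ t, h (-t) = -h t) ∧
    ∫ t, ‖h t‖ ^ 2 = (1 : ℝ) ∧ (weilQuadratic h).re ≤ -η
  intro hRH
  obtain ⟨η, hη, A, hA⟩ := H hRH
  refine ⟨η, hη, A, fun a ha => ?_⟩
  obtain ⟨h, h1, h2, h3, -, h5, h6⟩ := hA a ha
  exact ⟨h, h1, h2, h3, h5, h6⟩

/-- THE CRUX BY NAME, unconditionally. -/
theorem oddNegativityOffLine :
    Summit.RiemannHypothesis.RiemannHypothesis.Theses.OddSector.OddNegativityOffLine :=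
  oddNegativityOffLine_of_real oddRealNegativityOffLine

end Summit.RiemannHypothesis.RiemannHypothesis.Cruxes.OddNegativityOffLine.ContraposeLandedOddCriterion

end
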